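import Mathlib
import Literature.GroupTheory.CombinatorialGroupTheory.SignedHurwitzAction
import Literature.GroupTheory.CombinatorialGroupTheory.SignedHurwitzStabilisation
import Summits.SmoothPoincare4.SmoothPoincare4.Theses.ConvexBisection
import Summits.SmoothPoincare4.SmoothPoincare4.Theorems.ConvexBisectionAcyclicBisectionExistsStubSortBiSpan
import Summits.SmoothPoincare4.SmoothPoincare4.Theorems.ConvexBisectionAcyclicBisectionExistsStubReductionLift
import Summits.SmoothPoincare4.SmoothPoincare4.Theorems.ConvexBisectionAcyclicBisectionExistsStubExchange
import Summits.SmoothPoincare4.SmoothPoincare4.Theorems.ConvexBisectionAcyclicBisectionExistsStubReachInvariants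
import Summits.SmoothPoincare4.SmoothPoincare4.Theorems.AcyclicBisectionExists.Negative.TwistedDoubles
import Summits.SmoothPoincare4.SmoothPoincare4.Theorems.AcyclicBisectionExists.Negative.OneSided
import Literature.Topology.FourManifolds.Gluing
import Literature.Geometry.Symplectic.PlanarContactBoundary
import Literature.Geometry.Symplectic.SteinDomain
import Literature.AlgebraicTopology.SingularHomology.SingularChains
import HarnessLib
import HarnessLib.Audit

/-!
# Line `modp-braid-orbits` for crux `ConvexBisection.AcyclicBisectionExists` (stmt-SmoothPoincare4-10508)

LEAD skeleton, reshape **r5** (prover-line-stmt-SmoothPoincare4-10508-1, 2026-08-16), on top of lead -0's r3 and my r4.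
The crux: every homotopy 4-sphere `M` admits a Stein bisection along a common contact seam whose halves
are ℚ-acyclic.

History.  Planner skeleton (crux-plan r1, triage r1-1/2/3): stubs `stub_sortedModel` (dictionary, XL),
`stub_acyclicRight`, `stub_modpOrbit` (finite mod-`p` engine), `stub_sortBiSpan`, `stub_reductionLift`.
Lead -0: r1 `stub_acyclicRight` LANDED p72264; r2 vocabulary to the tree (`SignedHurwitzAction.lean`
p72321), `stub_sortBiSpan` LANDED p72877, `stub_reductionLift` LANDED p73050; r3 engine E2 → E1
(`stub_exchange` LANDED p76279 over `SignedHurwitzTravel/Exchange.lean`, `stub_reachInvariants` LANDED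
p74995, `stub_modpOrbit` retired, realisation widened to `Reach`).  Lead -1 (this file), **r4**: the
dictionary's OUTPUT is cut down from the crux's point-set/`mfderiv` ∃-body to TWISTED-GLUE DATA in the
tree's gluing vocabulary — two abstract compact Stein domains `(W₁,S₁)`, `(W₂,S₂)`, boundary data
`b₁ b₂`, a diffeomorphism `ψ : ∂W₁ ≅ ∂W₂` carrying the `S₁`-induced boundary plane field to the
`S₂`-complex tangencies, and `IsBoundaryGluing b₁ b₂ ψ (𝓡 4) M` ("`M = W₁ ∪_ψ W₂`"), `W₁` connected and
ℚ-acyclic — which is literally what Baykur's Thm 5.1 proof outputs (`X₊`, `−X₋`, the identification of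
`∂X₊` with `∂(−X₋)`); the packaging into embeddings/ranges/pushed-forward planes is the NEW Mathlib-only
stub `stub_glueWitness` (= the disprover's landed `Negative.Witness.ofTwistedGlue` + one-sided acyclicity
`Negative.Witness.acyclicRight_of_acyclicLeft_of_homotopyEquiv'`).  `stub_acyclicRight` (landed) leaves the
composition path (subsumed by `stub_glueWitness`) and stays a support of the item.

**r5** (same session): the CONTACT-MATCHING tail of the dictionary is peeled off the geometric stub along
three classical, separately citable steps, all stated over EXISTING tree vocabulary: the dictionary
(`stub_sortedModelOpenBook`) now outputs Baykur's Thm 5.1 conclusion verbatim — Stein structures on the two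
pieces whose induced boundary plane fields are supported, with the same orientation, by ONE open book
(`Literature.Geometry.Symplectic.OpenBook`, `OpenBook.IsGirouxForm`) on the seam — plus the gluing
`IsBoundaryGluing b₁ b₂ φ (𝓡 4) M` and the homology bookkeeping; then `stub_girouxGray` (Giroux 2002
uniqueness + Gray 1959 stability: two positive contact structures supported by the same open book differ by
a diffeomorphism isotopic to the identity), `stub_isotopyRegluing` (Hirsch 8.2.3 in the tree's relational
form: `M` is also a `(φ₀ ≫ φ)`-gluing — tree `IsBoundaryGluing.of_isSmoothlyIsotopic`), and
`stub_contactoPlanes` (chain rule: the re-glued identification carries `boundaryPlaneField S₁` onto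
`contactPlane S₂` pointwise) feed the landed `stub_glueWitness`.

Chain (each arrow a registered stub; the composition `AcyclicBisectionExists_of` is PROVED below):

  `M ≃ₕ S⁴`
  —[`stub_sortedModelOpenBook` (dictionary, r5 signature; geometric, XL): Akbulut–Matveyev arXiv:math/0010166
     Thm 3 (FOLDED: `X̃₁`, `−X̃₂` PC) + Cor 1 (`X̃₁` contractible for `π₁ M = 1`; seam a ℤHS³) → PALFs on
     `X̃₁` and on `−X̃₂` (Akbulut–Ozbagci arXiv:math/0012239 Thm 5 / Loi–Piergallini) → Etnyre–Fuller
     arXiv:math/0510008 §3–4 matching by ± stabilisations inside each piece, equal numbers of negative ones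
     on the two sides because `d₃(ξ₁) = d₃(ξ₂) = −1/2` on the ℤHS³ seam (Gompf's `d₃` formula; each negative
     stabilisation shifts `d₃` by `+1`), binding kept connected (Baykur Lemma 1) → the one-word integral model
     `l₁ ++ l₂` on `H₁(F_{g,1};ℤ) = ℤ^{2g}`; REALISATION: every `(g', l')` reachable by signed Hurwitz moves
     (Baykur arXiv:math/0601396 §5 pp.12–13: conjugated arcs on the capped fibration `Ŷ → S²`) and
     stabilisation-pair moves (two Etnyre–Fuller stabilisations of the bisection cut at the insertion point,
     positive in `X_A`, positive in `−X_B`) that is SORTED with positive and negative classes ℚ-bases is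
     Baykur's split `M = X₊ ∪ X₋`, `X₊ = PALF(F'; P)`, `−X₋ = PALF(F'; rev N⁻¹)` (p.13), both Stein by the
     Akbulut–Ozbagci induction (p.14: Legendrian realisation on pages, framing `tb − 1`, Eliashberg, Gay),
     both induced contact structures on `H = ∂X₊ = ∂(−X₋)` supported by the common boundary open book;
     `X₊` connected, `b₁(X₊) = 2g' − rk⟨P⟩ = 0`, `b₂(X₊) = #P − rk⟨P⟩ = 0`, `H₁(X₊;ℤ) = ℤ^{2g'}/⟨P⟩]→
  integral signed word `l₁ ++ l₂`: halves of length `2g` spanning `ℤ^{2g}`, non-zero classes, `2g` positive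
  letters, signed transvection product `1`
  —[`stub_exchange` (E1 engine, LANDED p76279)]→ reachable `(g', l')`, `4g'` letters, `2g'` positive,
     positive classes spanning `ℚ^{2g'}`
  —[`stub_reachInvariants` (LANDED p74995)]→ trivial signed monodromy persists
  —[`stub_sortBiSpan` (LANDED p72877), over `ℚ` + `hurwitzOrbit_lift` (landed with p73050)]→ sorted
     bi-spanning integral word in the reach set → REALISATION → `M = W₁ ∪_φ W₂`, both boundary plane
     fields supported by one open book, `W₁` connected, ℚ-acyclic
  —[`stub_girouxGray` (NEW r5; Giroux 2002 + Gray 1959)]→ `φ₀ ≃ id` on `∂W₁` carrying `ξ₁'` onto `φ^*ξ₂'`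
  —[`stub_isotopyRegluing` (NEW r5; Hirsch 8.2.3, tree `IsBoundaryGluing.of_isSmoothlyIsotopic`)]→
     `M = W₁ ∪_{φ₀ ≫ φ} W₂`
  —[`stub_contactoPlanes` (NEW r5; chain rule)]→ `d(ι₂ ∘ φ ∘ φ₀)(ξ₁') = ξ₂` pointwise
  —[`stub_glueWitness` (r4, LANDED p78503): glue data ⇒ the crux's ∃-body, `W₂` ℚ-acyclic by one-sided
     duality over `M ≃ₕ S⁴`]→ `AcyclicBisectionExists`.

Disproof.lean (gen 3, re-read 2026-08-16T02:50Z) honoured: §3 `acyclicBisectionExists_false_without_homotopyEquiv`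
— `≃ₕ` consumed by `stub_sortedModelGlue` (AM Cor 1: `π₁ = 1`; balance needs the ℤHS seam) and by
`stub_glueWitness` (one-sided duality); §7 (ℂP²: `b₂(M) = 0` used); §4 (guard `0 < k` kept); §12–§13
consistent; §15 (`Negative/TwistedDoubles.lean`) now ON the composition path; §14 Targets: no stub of
this line refuted; drefute r1+r3: 0 stub-false, 0 stub-misstated (p73614, p76067 record the load-bearing
hypotheses of the retired `stub_modpOrbit` and of `stub_exchange`).
-/

noncomputable section

set_option linter.dupNamespace false

open scoped Manifold ContDiff Topology ContinuousMap

namespace Summit.SmoothPoincare4.SmoothPoincare4.Cruxes.AcyclicBisectionExists.ModpBraidOrbits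

open Literature.GroupTheory.CombinatorialGroupTheory.SignedHurwitz
open Summit.SmoothPoincare4.SmoothPoincare4.Theorems.AcyclicBisectionExists.ModpBraidOrbits
  (map_wordProduct hurwitzOrbit_lift)
open Literature.Topology.FourManifolds (BoundaryData IsBoundaryGluing)
open Literature.Geometry.Symplectic (SteinStructure contactPlane boundaryPlaneField OpenBook wedge₁₂)
open Literature.AlgebraicTopology.SingularHomology (singularHomology)
open Summit.SmoothPoincare4.SmoothPoincare4.Theorems.AcyclicBisectionExists.Negative
  (Witness HasAcyclicSteinBisection Witness.ofTwistedGlue)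

/-! ## Vocabulary

`sgn`, `HurwitzStep`, `HurwitzOrbit`, `letters`, `classesOfSign`, `Sorted`, `transvection`, `wordProduct`,
`mapWord`, `stdSymp`, `ratWord` (+ bookkeeping): `Literature/GroupTheory/CombinatorialGroupTheory/SignedHurwitzAction.lean`
(p72321).  `IntWord`, `IsPrimitive`, `embed`, `newE`, `newF`, `stabBlock`, `StabStep`, `Reach` (+ bookkeeping):
`Literature/GroupTheory/CombinatorialGroupTheory/SignedHurwitzStabilisation.lean`.  Both namespaces
`Literature.GroupTheory.CombinatorialGroupTheory.SignedHurwitz`, opened above. -/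

/-! ## Stub 1 — the sorted-model dictionary (geometric; r5 signature: realisation as a gluing with ONE
supporting open book on the seam = Baykur Thm 5.1's conclusion + homology)

For every homotopy 4-sphere `M` there are `g` and integral signed words `l₁`, `l₂` over the standard
symplectic lattice `ℤ^{2g} = H₁(F_{g,1};ℤ)` — the one-word model `l₁ ++ l₂` of the matched pair of
achiral Lefschetz fibrations over `D²` obtained from the Akbulut–Matveyev folded pair of `M`
(arXiv:math/0010166 Thm 3 + Cor 1: `X̃₁` contractible PC, `−X̃₂` PC, hence ℤ-acyclic, seam a ℤHS³) by
PALFs on both pieces (Akbulut–Ozbagci arXiv:math/0012239 / Loi–Piergallini arXiv:math/0002042) and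
Etnyre–Fuller (arXiv:math/0510008 §§3–4) common ± stabilisation realised by (a)chiral Lefschetz handle
pairs inside each piece, binding kept connected (Baykur arXiv:math/0601396 Lemma 1) — such that: each
half has `2g` letters (`χ = 1`) spanning `ℤ^{2g}` (`H₁(X̃ᵢ;ℤ) = 0`), all classes are non-zero
(allowable fibrations), exactly `2g` of the `4g` letters are positive (equal numbers of negative
stabilisations on the two sides: `d₃(ξ₁) = d₃(ξ₂) = −1/2` on the ℤHS³ seam and each negative
stabilisation shifts `d₃` by `+1`), the signed transvection product is `1` (`μ₁ μ₂ = 1`, Baykur p.12);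
and the REALISATION clause: every `(g', l')` reachable from `l₁ ++ l₂` by signed Hurwitz moves
(re-choices of arcs on the capped fibration `Ŷ → S²`, Baykur pp.12–13) and stabilisation-pair moves
(`StabStep`: two Etnyre–Fuller stabilisations of the bisection cut at the insertion point, new classes
`e + c`, `f`, `c` the — primitive or zero — class of the first arc) which is SORTED with positive and
negative classes ℚ-bases is realised by Baykur's split (p.13) `M = X₊ ∪_H X₋`, `X₊ = PALF(F'; P)`,
`−X₋ = PALF(F'; rev N⁻¹)`, both compact Stein (p.14: Akbulut–Ozbagci induction — Legendrian realisation
on pages, framing `tb − 1`, Eliashberg, Gay), the two induced contact structures on `H = ∂X₊ = ∂(−X₋)`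
both supported by the common boundary open book (pages `F'`, binding `∂F'`) — recorded in the TREE'S
VOCABULARY: abstract compact Stein domains `(W₁,S₁) = X₊`, `(W₂,S₂) = −X₋`, boundary data `b₁ b₂`,
the identification `φ : ∂W₁ ≅ ∂W₂` with `IsBoundaryGluing b₁ b₂ φ (𝓡 4) M`, an open book `ob` on
`b₁.carrier` and Giroux forms `α₁` for `ξ₁' = boundaryPlaneField S₁.J b₁` and `α₂` for the pulled-back
field `φ^* ξ₂'`, `ξ₂' = boundaryPlaneField S₂.J b₂`, inducing the same orientation (both contact
structures are positive on `H`); with `W₁` connected, ℚ-acyclic (`b₁ = 2g' − rk⟨P⟩ = 0`,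
`b₂ = #P − rk⟨P⟩ = 0`) and the ANCHOR `H₁(W₁;ℤ) ≅ ℤ^{2g'}/⟨[P]⟩`.  Size XL by vocabulary (no Lefschetz
fibration / open-book monodromy / stabilisation in the tree); first missing stateable facts: the folded
homotopy-controlled Akbulut–Matveyev theorem (Thm 3 + Cor 1 over `IsSteinDomain`, `IsBoundaryGluing`,
`ContractibleSpace`) and a definition of Lefschetz handlebodies over `D²` with their boundary open book
(memo `StubSortedModelGlueMemo.md` in the crux directory). -/
theorem stub_sortedModelOpenBook :
    ∀ (M : Type) [TopologicalSpace M] [T2Space M] [SecondCountableTopology M]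
      [ChartedSpace (EuclideanSpace ℝ (Fin 4)) M] [IsManifold (𝓡 4) ∞ M],
      M ≃ₕ Metric.sphere (0 : EuclideanSpace ℝ (Fin 5)) 1 →
      ∃ (g : ℕ) (l₁ l₂ : IntWord g),
        l₁.length = 2 * g ∧ l₂.length = 2 * g ∧
        ((l₁ ++ l₂).filter (·.2)).length = 2 * g ∧
        Submodule.span ℤ (letters l₁) = ⊤ ∧ Submodule.span ℤ (letters l₂) = ⊤ ∧
        (∀ x ∈ l₁ ++ l₂, x.1 ≠ 0) ∧
        wordProduct (stdSymp ℤ g) (l₁ ++ l₂) = 1 ∧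
        ∀ (g' : ℕ) (l' : IntWord g'),
          Reach g (l₁ ++ l₂) g' l' → Sorted l' →
          Submodule.span ℚ (classesOfSign (ratWord l') true) = ⊤ →
          Submodule.span ℚ (classesOfSign (ratWord l') false) = ⊤ →
          ∃ (W₁ : Type) (_ : TopologicalSpace W₁) (_ : ChartedSpace (EuclideanHalfSpace 4) W₁)
            (_ : IsManifold (𝓡∂ 4) ∞ W₁) (_ : CompactSpace W₁)
            (W₂ : Type) (_ : TopologicalSpace W₂) (_ : ChartedSpace (EuclideanHalfSpace 4) W₂)
            (_ : IsManifold (𝓡∂ 4) ∞ W₂) (_ : CompactSpace W₂)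
            (S₁ : SteinStructure W₁) (S₂ : SteinStructure W₂)
            (b₁ : BoundaryData (𝓡∂ 4) W₁ (𝓡 3)) (b₂ : BoundaryData (𝓡∂ 4) W₂ (𝓡 3))
            (φ : b₁.carrier ≃ₘ⟮𝓡 3, 𝓡 3⟯ b₂.carrier)
            (ob : OpenBook b₁.carrier)
            (α₁ α₂ : Literature.Geometry.Kaehler.MForm (𝓡 3) b₁.carrier ℝ 1),
            IsBoundaryGluing b₁ b₂ φ (𝓡 4) M ∧
            ob.IsGirouxForm (boundaryPlaneField S₁.J b₁) α₁ ∧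
            ob.IsGirouxForm (fun y => (boundaryPlaneField S₂.J b₂ (φ y)).comap
              (mfderiv (𝓡 3) (𝓡 3) φ y).toLinearMap) α₂ ∧
            (∀ y u v w, 0 < wedge₁₂ (α₁ y) (Literature.Geometry.Kaehler.mextDeriv α₁ y) u v w ↔
              0 < wedge₁₂ (α₂ y) (Literature.Geometry.Kaehler.mextDeriv α₂ y) u v w) ∧
            ConnectedSpace W₁ ∧
            (∀ k, 0 < k → CategoryTheory.Limits.IsZero (singularHomology ℚ ℚ W₁ k)) ∧
            Nonempty ((singularHomology ℤ ℤ W₁ 1) ≃ₗ[ℤ]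
              ((Fin g' ⊕ Fin g' → ℤ) ⧸ Submodule.span ℤ (classesOfSign l' true))) := by
  sorry

/-! ## Stub GG — Giroux uniqueness + Gray stability (NEW in r5; classical)

Two plane fields on a closed 3-manifold that are kernels of Giroux forms for the SAME open book
(`OpenBook.IsGirouxForm`: `α ∧ dα ≠ 0`, `dα > 0` on the `dθ`-co-oriented pages, `α > 0` on the binding
oriented as the boundary of the pages — all read in the orientation `α ∧ dα` defines), the two forms
inducing the same orientation, differ by a diffeomorphism isotopic to the identity: Giroux 2002 (two
contact structures supported by one open book are isotopic through contact structures: normalise near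
the binding, then `α_s + t·(page term)` — Etnyre, *Lectures on open book decompositions and contact
structures* (2006), Prop. 3.18 / Lemma 3.19) followed by Gray's stability theorem (Gray 1959; Geiges 2008,
Thm 2.2.2).  The orientation hypothesis is needed: the same embedded open book also carries the
mirror (negative) structure.  Size L–XL (Moser/Gray flow on a closed manifold is not in Mathlib). -/
theorem stub_girouxGray :
    ∀ (N : Type) [TopologicalSpace N] [T2Space N] [CompactSpace N]
      [ChartedSpace (EuclideanSpace ℝ (Fin 3)) N] [IsManifold (𝓡 3) ∞ N]
      (ob : OpenBook N) (ξ ξ' : N → Submodule ℝ (EuclideanSpace ℝ (Fin 3)))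
      (α α' : Literature.Geometry.Kaehler.MForm (𝓡 3) N ℝ 1),
      ob.IsGirouxForm ξ α → ob.IsGirouxForm ξ' α' →
      (∀ y u v w, 0 < wedge₁₂ (α y) (Literature.Geometry.Kaehler.mextDeriv α y) u v w ↔
        0 < wedge₁₂ (α' y) (Literature.Geometry.Kaehler.mextDeriv α' y) u v w) →
      ∃ φ₀ : N ≃ₘ⟮𝓡 3, 𝓡 3⟯ N,
        Literature.Topology.FourManifolds.Diffeomorph.IsIsotopic φ₀ (Diffeomorph.refl (𝓡 3) N ∞) ∧
        ∀ y, (ξ y).map (mfderiv (𝓡 3) (𝓡 3) φ₀ y).toLinearMap = ξ' (φ₀ y) := by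
  sorry

/-! ## Stub IR — re-gluing along an isotopic identification (NEW in r5; Hirsch 8.2.3, tree-provable)

If `M = W₁ ∪_φ W₂` and `φ₀ ∈ Diff ∂W₁` is isotopic to the identity, then also `M = W₁ ∪_{φ₀ ≫ φ} W₂`:
post-compose the isotopy with `φ` and apply the tree's PROVED
`Literature.Topology.FourManifolds.IsBoundaryGluing.of_isSmoothlyIsotopic` (`GluingIsotopyProofs.lean`).
Size S. -/
theorem stub_isotopyRegluing :
    ∀ (M : Type) [TopologicalSpace M] [T2Space M] [SecondCountableTopology M]
      [ChartedSpace (EuclideanSpace ℝ (Fin 4)) M] [IsManifold (𝓡 4) ∞ M]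
      (W₁ : Type) [TopologicalSpace W₁] [ChartedSpace (EuclideanHalfSpace 4) W₁]
        [IsManifold (𝓡∂ 4) ∞ W₁] [CompactSpace W₁]
      (W₂ : Type) [TopologicalSpace W₂] [ChartedSpace (EuclideanHalfSpace 4) W₂]
        [IsManifold (𝓡∂ 4) ∞ W₂] [CompactSpace W₂]
      (b₁ : BoundaryData (𝓡∂ 4) W₁ (𝓡 3)) (b₂ : BoundaryData (𝓡∂ 4) W₂ (𝓡 3))
      (φ : b₁.carrier ≃ₘ⟮𝓡 3, 𝓡 3⟯ b₂.carrier) (φ₀ : b₁.carrier ≃ₘ⟮𝓡 3, 𝓡 3⟯ b₁.carrier),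
      IsBoundaryGluing b₁ b₂ φ (𝓡 4) M →
      Literature.Topology.FourManifolds.Diffeomorph.IsIsotopic φ₀ (Diffeomorph.refl (𝓡 3) b₁.carrier ∞) →
      IsBoundaryGluing b₁ b₂ (φ₀.trans φ) (𝓡 4) M := by
  sorry

/-! ## Stub CP — the re-glued identification is a contactomorphism of plane fields (NEW in r5; chain rule)

If `dφ₀` carries `ξ₁' = boundaryPlaneField S₁.J b₁` onto the pull-back `φ^* ξ₂'` of
`ξ₂' = boundaryPlaneField S₂.J b₂`, then `d(ι₂ ∘ φ ∘ φ₀)` carries `ξ₁'` onto the complex tangencies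
`contactPlane S₂.J` pointwise — `dφ` is an isomorphism (so `map ∘ comap = id` along it) and `dι₂` maps the
pulled-back plane field onto `contactPlane S₂.J` (landed `Negative.map_mfderiv_incl_boundaryPlaneField`).
Size S–M. -/
theorem stub_contactoPlanes :
    ∀ (W₁ : Type) [TopologicalSpace W₁] [ChartedSpace (EuclideanHalfSpace 4) W₁]
        [IsManifold (𝓡∂ 4) ∞ W₁] [CompactSpace W₁]
      (W₂ : Type) [TopologicalSpace W₂] [ChartedSpace (EuclideanHalfSpace 4) W₂]
        [IsManifold (𝓡∂ 4) ∞ W₂] [CompactSpace W₂]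
      (S₁ : SteinStructure W₁) (S₂ : SteinStructure W₂)
      (b₁ : BoundaryData (𝓡∂ 4) W₁ (𝓡 3)) (b₂ : BoundaryData (𝓡∂ 4) W₂ (𝓡 3))
      (φ : b₁.carrier ≃ₘ⟮𝓡 3, 𝓡 3⟯ b₂.carrier) (φ₀ : b₁.carrier ≃ₘ⟮𝓡 3, 𝓡 3⟯ b₁.carrier),
      (∀ y, (boundaryPlaneField S₁.J b₁ y).map (mfderiv (𝓡 3) (𝓡 3) φ₀ y).toLinearMap =
        (boundaryPlaneField S₂.J b₂ (φ (φ₀ y))).comap (mfderiv (𝓡 3) (𝓡 3) φ (φ₀ y)).toLinearMap) →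
      ∀ z, Submodule.map (mfderiv (𝓡 3) (𝓡∂ 4) (b₂.incl ∘ (φ₀.trans φ)) z).toLinearMap
          (boundaryPlaneField S₁.J b₁ z) = contactPlane S₂.J (b₂.incl ((φ₀.trans φ) z)) := by
  sorry

/-! ## Stub G — twisted-glue data give the crux's ∃-body (NEW in r4) — LANDED p78503

Over `M ≃ₕ S⁴`: if `M = W₁ ∪_ψ W₂` is the boundary gluing of two compact Stein domains along a
diffeomorphism `ψ : ∂W₁ ≅ ∂W₂` carrying the `S₁`-induced boundary plane field onto the complex tangencies
of `S₂`, and `W₁` is connected and ℚ-acyclic in positive degrees, then `M` carries a witness of the crux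
with both halves ℚ-acyclic (`HasAcyclicSteinBisection M`).  Proof: the landed
`Negative.Witness.ofTwistedGlue b₁ b₂ S₁ S₂ ψ hψ hglue : Witness M` (its `W₁` is `W₁`) has the six
point-set/contact properties; its right half is ℚ-acyclic by the landed one-sided duality
`Negative.Witness.acyclicRight_of_acyclicLeft_of_homotopyEquiv'` (needs only `ConnectedSpace W₁`).
Size S.  LANDED as `Theorems/ConvexBisectionAcyclicBisectionExistsStubGlueWitness.lean` (p78503). -/
theorem stub_glueWitness :
    ∀ (M : Type) [TopologicalSpace M] [T2Space M] [SecondCountableTopology M]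
      [ChartedSpace (EuclideanSpace ℝ (Fin 4)) M] [IsManifold (𝓡 4) ∞ M],
      M ≃ₕ Metric.sphere (0 : EuclideanSpace ℝ (Fin 5)) 1 →
      ∀ (W₁ : Type) [TopologicalSpace W₁] [ChartedSpace (EuclideanHalfSpace 4) W₁]
        [IsManifold (𝓡∂ 4) ∞ W₁] [CompactSpace W₁]
        (W₂ : Type) [TopologicalSpace W₂] [ChartedSpace (EuclideanHalfSpace 4) W₂]
        [IsManifold (𝓡∂ 4) ∞ W₂] [CompactSpace W₂]
        (S₁ : SteinStructure W₁) (S₂ : SteinStructure W₂)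
        (b₁ : BoundaryData (𝓡∂ 4) W₁ (𝓡 3)) (b₂ : BoundaryData (𝓡∂ 4) W₂ (𝓡 3))
        (ψ : b₁.carrier ≃ₘ⟮𝓡 3, 𝓡 3⟯ b₂.carrier),
        (∀ z, Submodule.map (mfderiv (𝓡 3) (𝓡∂ 4) (b₂.incl ∘ ψ) z).toLinearMap
            (boundaryPlaneField S₁.J b₁ z) = contactPlane S₂.J (b₂.incl (ψ z))) →
        IsBoundaryGluing b₁ b₂ ψ (𝓡 4) M →
        ConnectedSpace W₁ →
        (∀ k, 0 < k → CategoryTheory.Limits.IsZero (singularHomology ℚ ℚ W₁ k)) →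
        HasAcyclicSteinBisection M := by
  -- LANDED (p78503) as `Summit.SmoothPoincare4.SmoothPoincare4.Theorems.AcyclicBisectionExists.ModpBraidOrbits.stub_glueWitness`
  -- (Theorems/ConvexBisectionAcyclicBisectionExistsStubGlueWitness.lean); proof repeated here verbatim so that the
  -- skeleton elaborates before the farm has rebuilt that module.
  intro M _ _ _ _ _ e W₁ _ _ _ _ W₂ _ _ _ _ S₁ S₂ b₁ b₂ ψ hψ hglue hconn hac
  let B : Witness M := Witness.ofTwistedGlue b₁ b₂ S₁ S₂ ψ hψ hglue
  haveI : Nonempty M := ⟨e.invFun ⟨EuclideanSpace.single 0 1, by simp⟩⟩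
  haveI : ConnectedSpace B.W₁ := hconn
  have hleft : B.AcyclicLeft := hac
  exact ⟨B, (B.acyclic_iff).2 ⟨hleft, B.acyclicRight_of_acyclicLeft_of_homotopyEquiv' e hleft⟩⟩

/-! ## Stub 2 — one-sided acyclicity suffices (LANDED p72264; off the r4 composition path)

`Summit.SmoothPoincare4.SmoothPoincare4.Theorems.AcyclicBisectionExists.ModpBraidOrbits.stub_acyclicRight`
(`Theorems/ConvexBisectionAcyclicBisectionExistsStubAcyclicRight.lean`, a repackaging of the disprover's
`Negative.Witness.acyclicRight_of_acyclicLeft_of_homotopyEquiv'`) stays a support of the item; in r4 the same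
duality is consumed inside `stub_glueWitness`, so the declaration is no longer restated here. -/

/-! ## Stub E — the EXCHANGE LEMMA (E1 engine; NEW in r3; replaces `stub_modpOrbit` + `stub_reductionLift`
on the composition path) — LANDED p76279 (with Literature/…/SignedHurwitzTravel.lean p75520, …/SignedHurwitzExchange.lean p75661)

For an integral signed word `l` at genus `g` with `4g` letters, `2g` of them positive, all classes
non-zero and all classes together spanning `ℚ^{2g}`: some `(g', l')` reachable by signed Hurwitz moves and
stabilisation-pair moves has `4g'` letters, `2g'` positive, and POSITIVE classes spanning `ℚ^{2g'}`.
Proof (hurwitz-tilt-exchange (5), one-word form; induction on the corank `r` of `U := span ℚ (positive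
classes)`): if `r > 0` pick a NEGATIVE letter `w ∉ U` (all letters span) and a REDUNDANT positive letter
`y` (`2g` positive letters inside `U`, `dim U < 2g`); move `w` next to `y` on its left by Hurwitz moves
that keep every positive class (passing a positive `q`: the option that keeps `q` and replaces `w` by
`w ± ω(q,w) q ∈ w + U`; passing a negative: the option that keeps `w`; the final pass over `y` itself if
`w` started on the right); cut between `w` and `y` and apply `StabStep` with a primitive `c` such that
`ω(c, w) ≠ 0 ≠ ω(c, y)` (a standard basis vector or a sum of two); tilt `u₁ = e + c` by `w`
(`u₁ ↦ u₁ − ω(w,c)·w`, positive) and `y` by `u₁⁻` (`y ↦ y − ω(c,y)·u₁`, positive): modulo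
`Ū = embed U` the three new positive classes are `e + c̄ + λ w̄`, `f`, `μ (e + c̄)` with `λ μ ≠ 0`,
`w̄ ≠ 0`, hence independent — `dim` of the positive span grows by `3` while the ambient dimension grows
by `2`: corank `r − 1`.  Invariants (`4g'` letters, `2g'` positive, non-zero classes, all classes span)
persist.  Size M–L (≈ 400 lines; Mathlib + the two vocabulary files). -/
theorem stub_exchange :
    ∀ (g : ℕ) (l : IntWord g),
      l.length = 4 * g → (l.filter (·.2)).length = 2 * g →
      (∀ x ∈ l, x.1 ≠ 0) →
      Submodule.span ℚ (letters (ratWord l)) = ⊤ →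
      ∃ (g' : ℕ) (l' : IntWord g'),
        Reach g l g' l' ∧ l'.length = 4 * g' ∧ (l'.filter (·.2)).length = 2 * g' ∧
        Submodule.span ℚ (classesOfSign (ratWord l') true) = ⊤ :=
  -- LANDED (p76279): Theorems/ConvexBisectionAcyclicBisectionExistsStubExchange.lean
  Summit.SmoothPoincare4.SmoothPoincare4.Theorems.AcyclicBisectionExists.ModpBraidOrbits.stub_exchange

/-! ## Stub R — reachability preserves trivial signed monodromy (NEW in r3) — LANDED p74995

Signed Hurwitz moves preserve `wordProduct` for the alternating pairing `stdSymp ℤ g'`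
(`T_{T_a^ε b}^{δ} T_a^{ε} = T_a^{ε} T_b^{δ}`), and a stabilisation-pair move does too: the block
`(e+c,+)(f,+)(f,−)(e+c,−)` has product `1` (`T_v^{+} T_v^{−} = 1`), and on `ℤ^{2g'+2} = embed ℤ^{2g'} ⊕ ⟨e,f⟩`
the embedded letters act by `embed ∘ T ∘ embed⁻¹ ⊕ id` (they are `ω`-orthogonal to `e, f`), so the
product of `embed A ++ block ++ embed B` is the lift of the product of `A ++ B`.  Size S–M (≈ 150 lines). -/
theorem stub_reachInvariants :
    ∀ (g : ℕ) (l : IntWord g) (g' : ℕ) (l' : IntWord g'),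
      Reach g l g' l' → wordProduct (stdSymp ℤ g) l = 1 → wordProduct (stdSymp ℤ g') l' = 1 :=
  -- LANDED (p74995): Theorems/ConvexBisectionAcyclicBisectionExistsStubReachInvariants.lean
  Summit.SmoothPoincare4.SmoothPoincare4.Theorems.AcyclicBisectionExists.ModpBraidOrbits.stub_reachInvariants

/-! ## Stub 4 — sorting and the second basis (LANDED p72877) -/

/-- **Stub `stub_sortBiSpan`**: over any field `K`, an orbit element with spanning positive classes can be
sorted inside the orbit keeping its positive classes, and then (product `1`, telescoping, non-degeneracy)
its negative classes span too.  LANDED as `Theorems/ConvexBisectionAcyclicBisectionExistsStubSortBiSpan.lean`. -/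
theorem stub_sortBiSpan :
    ∀ (K : Type) [Field K] (g : ℕ) (l m : List ((Fin g ⊕ Fin g → K) × Bool)),
      l.length = 4 * g → (l.filter (·.2)).length = 2 * g →
      wordProduct (stdSymp K g) l = 1 →
      HurwitzOrbit (stdSymp K g) l m → Submodule.span K (classesOfSign m true) = ⊤ →
      ∃ m' : List ((Fin g ⊕ Fin g → K) × Bool),
        HurwitzOrbit (stdSymp K g) l m' ∧ Sorted m' ∧
        Submodule.span K (classesOfSign m' true) = ⊤ ∧
        Submodule.span K (classesOfSign m' false) = ⊤ :=
  -- LANDED (p72877): Theorems/ConvexBisectionAcyclicBisectionExistsStubSortBiSpan.lean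
  Summit.SmoothPoincare4.SmoothPoincare4.Theorems.AcyclicBisectionExists.ModpBraidOrbits.stub_sortBiSpan

/-! ## Composition lemmas (sorry-free): passing from `ℤ` to `ℚ` -/

section RatLemmas

variable {g : ℕ}

/-- `ratWord` is the coordinatewise change of coefficients along `Int.castRingHom ℚ`. -/
theorem ratWord_eq_mapWord (l : IntWord g) :
    ratWord l = mapWord (fun (v : Fin g ⊕ Fin g → ℤ) i => Int.castRingHom ℚ (v i)) l := rfl

/-- If integral classes span `ℤ^{2g}` over `ℤ`, their images span `ℚ^{2g}` over `ℚ`. -/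
theorem span_rat_image_eq_top {C : Set (Fin g ⊕ Fin g → ℤ)} (h : Submodule.span ℤ C = ⊤) :
    Submodule.span ℚ ((fun (v : Fin g ⊕ Fin g → ℤ) i => (v i : ℚ)) '' C) = ⊤ := by
  classical
  -- the ℤ-linear change of coefficients
  let ρ : (Fin g ⊕ Fin g → ℤ) →ₗ[ℤ] (Fin g ⊕ Fin g → ℚ) :=
    { toFun := fun v i => (v i : ℚ)
      map_add' := fun v w => funext fun i => by simp
      map_smul' := fun c v => funext fun i => by simp }
  have hρC : Submodule.map ρ (Submodule.span ℤ C) ≤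
      (Submodule.span ℚ ((fun (v : Fin g ⊕ Fin g → ℤ) i => (v i : ℚ)) '' C)).restrictScalars ℤ := by
    rw [Submodule.map_span]
    exact Submodule.span_le_restrictScalars ℤ ℚ _
  -- every standard basis vector is hit
  refine eq_top_iff.2 ((Pi.basisFun ℚ (Fin g ⊕ Fin g)).span_eq ▸ Submodule.span_le.2 ?_)
  rintro _ ⟨i, rfl⟩
  have hi : (Pi.single i (1 : ℤ) : Fin g ⊕ Fin g → ℤ) ∈ Submodule.span ℤ C := h ▸ Submodule.mem_top
  have hmem := hρC (Submodule.mem_map_of_mem hi)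
  have hρ : ρ (Pi.single i (1 : ℤ)) = (Pi.basisFun ℚ (Fin g ⊕ Fin g)) i := by
    ext j; simp [ρ, Pi.basisFun_apply, Pi.single_apply]
  rw [hρ] at hmem
  exact hmem

/-- Trivial integral signed monodromy stays trivial over `ℚ`. -/
theorem wordProduct_ratWord_eq_one {l : IntWord g} (h : wordProduct (stdSymp ℤ g) l = 1) :
    wordProduct (stdSymp ℚ g) (ratWord l) = 1 := by
  refine (Pi.basisFun ℚ (Fin g ⊕ Fin g)).ext fun i => ?_
  have key := map_wordProduct (Int.castRingHom ℚ) g l (Pi.single i 1)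
  rw [h] at key
  have hb : (Pi.basisFun ℚ (Fin g ⊕ Fin g)) i = fun j => Int.castRingHom ℚ ((Pi.single i (1 : ℤ) : _ → ℤ) j) := by
    ext j; simp [Pi.basisFun_apply, Pi.single_apply]
  rw [hb, ratWord_eq_mapWord, ← key]
  rfl

end RatLemmas

/-! ## Composition — the crux from the stubs (no `sorry` outside the stubs) -/

/-- **`AcyclicBisectionExists` from the line (r5).** Dictionary (Stub 1) → exchange engine (Stub E) →
monodromy invariance (Stub R) → over `ℚ`: sorted bi-spanning word in the Hurwitz orbit (Stub 4) → lifted to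
the integral orbit (`hurwitzOrbit_lift`) → realisation clause: Baykur's split `M = W₁ ∪_φ W₂` with one open
book supporting both boundary plane fields, `W₁` connected and ℚ-acyclic → Giroux–Gray (Stub GG) →
re-gluing along the isotopic identification (Stub IR) → pointwise plane matching (Stub CP) → a witness of the
crux, `W₂` ℚ-acyclic by one-sided duality (Stub G). -/
theorem AcyclicBisectionExists_of :
    _root_.Summit.SmoothPoincare4.SmoothPoincare4.Theses.ConvexBisection.AcyclicBisectionExists := by
  intro M _ _ _ _ _ e
  -- Stub 1: the integral model of `M` (uses `M ≃ₕ S⁴`)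
  obtain ⟨g, l₁, l₂, hlen₁, hlen₂, hbal, hsp₁, _hsp₂, hnz, hprod, hreal⟩ := stub_sortedModelOpenBook M e
  have hlen : (l₁ ++ l₂).length = 4 * g := by rw [List.length_append, hlen₁, hlen₂]; ring
  -- all classes span over `ℚ` (already the first half does)
  have hspanQ : Submodule.span ℚ (letters (ratWord (l₁ ++ l₂))) = ⊤ := by
    rw [ratWord, letters_mapWord, letters_append, Set.image_union]
    exact eq_top_iff.2 ((span_rat_image_eq_top hsp₁).symm.le.trans (Submodule.span_mono Set.subset_union_left))
  -- Stub E: the exchange engine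
  obtain ⟨g', l', hreach, hlen', hbal', hpos'⟩ := stub_exchange g (l₁ ++ l₂) hlen hbal hnz hspanQ
  -- Stub R: trivial monodromy persists, then descends to `ℚ`
  have hprodQ : wordProduct (stdSymp ℚ g') (ratWord l') = 1 :=
    wordProduct_ratWord_eq_one (stub_reachInvariants g (l₁ ++ l₂) g' l' hreach hprod)
  -- Stub 4 over `ℚ`: a sorted bi-spanning word in the Hurwitz orbit of `ratWord l'`
  obtain ⟨m', hm', hsorted', hposQ, hnegQ⟩ := stub_sortBiSpan ℚ g' (ratWord l') (ratWord l')
    (by rw [ratWord, length_mapWord, hlen']) (by rw [ratWord, length_filter_mapWord, hbal']) hprodQ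
    (HurwitzOrbit.refl _ _) hpos'
  -- lift it to the integral orbit
  obtain ⟨l'', hl'', hrat⟩ := hurwitzOrbit_lift (Int.castRingHom ℚ) g' l' (m := m')
    (by rwa [← ratWord_eq_mapWord])
  rw [← ratWord_eq_mapWord] at hrat
  subst hrat
  have hsorted : Sorted l'' := Sorted.of_mapWord _ hsorted'
  have hreach'' : Reach g (l₁ ++ l₂) g' l'' := hreach.trans_hurwitzOrbit hl''
  -- Stub 1 (realisation clause): Baykur's split `M = W₁ ∪_φ W₂`, one open book supporting both fields
  obtain ⟨W₁, _, _, _, _, W₂, _, _, _, _, S₁, S₂, b₁, b₂, φ, ob, α₁, α₂, hglue, hG₁, hG₂, hor, hconnW,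
      hacyc₁, _⟩ := hreal g' l'' hreach'' hsorted hposQ hnegQ
  -- Stub GG: Giroux uniqueness + Gray on the seam `∂W₁`
  haveI : T2Space W₁ := (hglue.isClosedGluing.choose_spec.choose_spec.1).isEmbedding.t2Space
  haveI : CompactSpace b₁.carrier := b₁.compactSpace_carrier
  haveI : T2Space b₁.carrier := b₁.isSmoothEmbedding.isEmbedding.t2Space
  obtain ⟨φ₀, hiso, hφ₀⟩ := stub_girouxGray b₁.carrier ob _ _ α₁ α₂ hG₁ hG₂ hor
  -- Stub IR: `M` is also the `(φ₀ ≫ φ)`-gluing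
  have hglue' := stub_isotopyRegluing M W₁ W₂ b₁ b₂ φ φ₀ hglue hiso
  -- Stub CP: the new identification carries `ξ₁'` onto `contactPlane S₂.J`
  have hψ := stub_contactoPlanes W₁ W₂ S₁ S₂ b₁ b₂ φ φ₀ hφ₀
  -- Stub G: glue data ⇒ a witness of the crux with both halves ℚ-acyclic
  obtain ⟨B, hB⟩ := stub_glueWitness M e W₁ W₂ S₁ S₂ b₁ b₂ (φ₀.trans φ) hψ hglue' hconnW hacyc₁
  exact ⟨B.W₁, inferInstance, inferInstance, inferInstance, inferInstance, B.W₂, inferInstance,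
    inferInstance, inferInstance, inferInstance, B.J₁, B.J₂, B.e₁, B.e₂, B.emb₁, B.emb₂, B.cover,
    B.inter₁, B.inter₂, B.contact, hB⟩

end Summit.SmoothPoincare4.SmoothPoincare4.Cruxes.AcyclicBisectionExists.ModpBraidOrbits

end
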